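import Summits.ABC.IUTFork.Joshi.FundamentalEstimateBLReadings
import HarnessLib

/-!
# R-J rows Y-31 / Y-32 (C-040 / C-054): the CHARITABLE branch is NON-VACUOUS — an interface-level datum WITH A BAD PLACE
# carrying `StandardPointNorms`, at which the local step and Thm. 7.3.1 as typed fire; the four-corner table of (C-040, C-054)

Test-side companion of the abc-iut cell, block E → R-J «JOSHI Y-DISCHARGE CENSUS» (D-0079; rung LADDER-ABC:A2.RESCUE.J), rows Y-31
(`ATS3.AdelicThetaDatum.FundamentalEstimateBL`, C-040) and Y-32 (`….LocalThetaEstimateAt`, C-054); seat abc-iut-E-t52 (gen 5), written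
as the NON-VACUITY rider surfaced by this seat's counted third-reader read of the Y-31/Y-32 package (abc-iut-E-t12 gen 8
`Joshi/FundamentalEstimateBLReadings.lean` p454590 + `Joshi/TestFundamentalEstimateBLContainer.lean` p456413; abc-iut-E-t13 gen 7
`Joshi/TestFundamentalEstimateBLRealisable.lean` p455172 + `Joshi/StandardPointNormsCanonical.lean` p456909; offered authors-first on
HOME/STATUS.md). Parents BY NAME, nothing restated: the CHARITABLE reading `StandardPointNorms` of K. Joshi, arXiv:2401.13508**v4**
([J-III]; unrefereed; bib `Joshi2024ATS3`) Prop. 6.6.1 / proof of Thm. 7.3.1 p.56 l.29–37 (abc-iut-E-t12, `Joshi/FundamentalEstimateBLStandard.lean`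
p429865: `|Ξ^{α_w}_{0,z_Θ,w,j}|_{B,ρ} = |q_w|^{(1/2ℓ)(j²/ℓ⋆²)}`), and p454590's census package `census_C040_C054`, whose first branch reads
«`StandardPointNorms ⟹ (∀ ρ ∈ (0,1], C-054 at ρ) ∧ C-040`».

WHY. The tree's interface-level data for the §7 signature are `toyDatum` (Ξ = (2,2), p429522), `trivialDatum` (𝕍^{odd,ss} = ∅, p429522),
`literalDatum` / `eigenDatum` (the LITERAL values, p454590) and `lineDatum` (p455172); NONE carries `StandardPointNorms` together with a
bad place, and p456909's `standardPointNorms_of_canonicalPoint` leaves the adelic glue (G1)–(G3)+(ANS) uninstantiated (as it says).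
So no NAMED declaration yet shows the charitable branch non-vacuous (CONVENTIONS §4 vacuity hygiene; census row Y-26 taught the cell
that «∀ data ⟹ …» theorems over these signatures can be vacuous). This file supplies one: `stdDatum`.

RESULTS (kernel; interface level — real numbers, NOT a model of [FF18]'s rings, exactly like the parents' witnesses):
* `stdDatum_standardPointNorms` — `stdDatum` (one place, `ℓ⋆ = 2`, `B = ℝ`, `|·|_ρ = |·|`, `|q| = 1/2`, singleton locus with the
  CHARITABLE coordinate values `|q|^{(1/10)(j²/4)}`) carries `StandardPointNorms`; `stdDatum_Vss_nonempty` — it has a bad place.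
* `stdDatum_profile` — at every `ρ ∈ (0,1]`: STD ∧ 𝕍^{odd,ss} ≠ ∅ ∧ C-054 at `ρ` ∧ `qBound < |Ξ_std|_ρ` STRICTLY ∧ C-040 — the
  charitable branch of `census_C040_C054` FIRES at a datum with a bad place.
* `fourCorners` — the truth-table of (C-040, C-054 at `ρ`) over the typed signature: (T,T) `stdDatum`, (T,F) `eigenDatum`,
  (F,F) `literalDatum` (p454590), and (F,T) EXCLUDED for every datum (`fundamentalEstimateBL_of_localThetaEstimateAt`, p428437).
No new `Prop`; one DATA def; no FACT-LIST row; nothing of [J-III] asserted. TAKES NO SIDE on [IUTchIII] Cor. 3.12, on Joshi's claims or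
on Mochizuki's report on them (or on Scholze–Stix / Dupuy–Hilado); typed ≠ proved ≠ endorsed; NOT an abc claim.
-/

noncomputable section

open Set Finset

namespace Summit.ABC.IUTFork.Joshi.ATS3

/-- **`stdDatum`** — one place (`𝕍_{L′} = 𝕍^{odd,ss} = {∗}`), `ℓ⋆ = 2` (`ℓ = 5`), `B = ℝ` with `|·|_ρ = |·|` at every `ρ`, `|q| = 1/2`,
and the locus the singleton `{Ξ^α_{0,z_Θ}}` with the CHARITABLE coordinate values `|q|^{(1/2ℓ)(j²/ℓ⋆²)} = (1/2)^{(1/10)(j²/4)}`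
(p429865's `stdExponent`). Interface-level witness (real numbers), NOT a model of [FF18]'s rings. [folklore] -/
def stdDatum : AdelicThetaDatum where
  W := Unit
  Vss := Finset.univ
  lstar := 2
  two_le_lstar := le_rfl
  prime_ell := Nat.prime_five
  B := fun _ => ℝ
  one := fun _ => 1
  nrm := fun _ _ x => |x|
  nrm_nonneg := fun _ _ x => abs_nonneg x
  nrm_one := fun _ _ => abs_one
  top := fun _ => inferInstance
  continuous_nrm := fun _ _ _ => continuous_abs
  Bplus := fun _ => {x | |x| ≤ 1}
  nrm_le_one_of_mem_Bplus := fun _ _ hx => hx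
  Idx := Unit
  Xi := fun _ _ i => (1 / 2 : ℝ) ^ ((1 / (2 * ((2 * 2 + 1 : ℕ) : ℝ))) * ((((((i : ℕ) : ℝ) + 1) ^ 2) / ((2 : ℕ) : ℝ) ^ 2)))
  Xi_off := fun _ w hw => absurd (Finset.mem_univ w) hw
  std := ()
  qAbs := fun _ => 1 / 2
  qAbs_pos := fun _ _ => by norm_num
  qAbs_lt_one := fun _ _ => by norm_num

/-- `stdDatum` carries the CHARITABLE norm values `StandardPointNorms` (p429865) at its distinguished (only) element. [folklore] -/
theorem stdDatum_standardPointNorms : stdDatum.StandardPointNorms := by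
  intro w _ ρ _ i
  show |(1 / 2 : ℝ) ^ ((1 / (2 * ((2 * 2 + 1 : ℕ) : ℝ))) * ((((((i : ℕ) : ℝ) + 1) ^ 2) / ((2 : ℕ) : ℝ) ^ 2)))| =
    (1 / 2 : ℝ) ^ stdDatum.stdExponent i
  rw [abs_of_nonneg (Real.rpow_nonneg (by norm_num) _)]
  rfl

/-- `stdDatum` has a bad place (`𝕍^{odd,ss} = {∗} ≠ ∅`). [folklore] -/
theorem stdDatum_Vss_nonempty : stdDatum.Vss.Nonempty := ⟨(), Finset.mem_univ (α := Unit) ()⟩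

/-- **The charitable branch of `census_C040_C054` is NON-VACUOUS**: at `stdDatum`, for every `ρ ∈ (0,1]`, `StandardPointNorms`
holds WITH a bad place, the local step C-054 holds at `ρ`, the distinguished element STRICTLY dominates Joshi's q-bound
(`qBound < |Ξ^α_{0,z_Θ}|_{B_{L′},ρ}`, contentful because `𝕍^{odd,ss} ≠ ∅`), and Thm. 7.3.1 AS TYPED (C-040) holds — all by p454590's
package and p428437's passage to the product, BY NAME. [folklore] -/
theorem stdDatum_profile {ρ : ℝ} (hρ : ρ ∈ Set.Ioc (0 : ℝ) 1) :
    stdDatum.StandardPointNorms ∧ stdDatum.Vss.Nonempty ∧ stdDatum.LocalThetaEstimateAt ρ ∧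
      stdDatum.qBound < stdDatum.adelicSize ρ (stdDatum.Xi stdDatum.std) ∧ stdDatum.FundamentalEstimateBL :=
  have h := (census_C040_C054 stdDatum).1 stdDatum_standardPointNorms
  ⟨stdDatum_standardPointNorms, stdDatum_Vss_nonempty, h.1 ρ hρ,
    stdDatum.qBound_lt_adelicSize_std (h.1 ρ hρ) stdDatum_Vss_nonempty, h.2⟩

/-- **The four-corner table of (C-040, C-054 at `ρ`) over the typed §7 signature**, every `ρ ∈ (0,1]`: (TRUE, TRUE) at `stdDatum`
(charitable values), (TRUE, FALSE) at `eigenDatum` and (FALSE, FALSE) at `literalDatum` (p454590, literal values — container-decided),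
while (FALSE, TRUE) is EXCLUDED for every datum: C-054 at one `ρ ∈ (0,1]` implies C-040 (p428437). So C-054 is sufficient and not
necessary for C-040 as typed, and each realisable corner is inhabited by a datum WITH a bad place. [folklore] -/
theorem fourCorners {ρ : ℝ} (hρ : ρ ∈ Set.Ioc (0 : ℝ) 1) :
    (stdDatum.FundamentalEstimateBL ∧ stdDatum.LocalThetaEstimateAt ρ) ∧
      (eigenDatum.FundamentalEstimateBL ∧ ¬ eigenDatum.LocalThetaEstimateAt ρ) ∧
      (¬ literalDatum.FundamentalEstimateBL ∧ ¬ literalDatum.LocalThetaEstimateAt ρ) ∧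
      ∀ D : AdelicThetaDatum, ¬ (¬ D.FundamentalEstimateBL ∧ D.LocalThetaEstimateAt ρ) :=
  ⟨⟨(stdDatum_profile hρ).2.2.2.2, (stdDatum_profile hρ).2.2.1⟩,
    ⟨(eigenDatum_profile hρ).2.2.2, (eigenDatum_profile hρ).2.1⟩,
    ⟨(literalDatum_profile hρ).2.2.2, (literalDatum_profile hρ).2.1⟩,
    fun D h => h.1 (D.fundamentalEstimateBL_of_localThetaEstimateAt hρ h.2)⟩

end Summit.ABC.IUTFork.Joshi.ATS3

end
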